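import Summits.QuantumFields.YangMills.Theorems.EntropyBudgetEquipartitionCovTransferLaw
import HarnessLib

/-!
# Route `EntropyBudgetEquipartition`, crux `EntropyBudgetTransfer` (stmt-QuantumFields-22401) — helper «KT3 → KT»,
# part 5: the same reduction with closeness tested on CONTINUOUS bounded functions only

HONEST LABEL: bookkeeping toward a RECORD-label rung (R2ξ-G, `WeakCouplingRates.XiPow`); the Yang–Mills mass gap is NOT
proved by any of this, and neither is the crux.

Parts 1–3 (`…CovTransfer.lean`, `…CovTransferTorus.lean`, `…CovTransferLaw.lean`) asked hypothesis (i) — closeness of the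
pair laws — on all MEASURABLE test functions `|h| ≤ 1` (total variation, what Pinsker delivers).  The truncation argument only ever
tests the three CONTINUOUS functions `[x]₀^m [y]₀^m / m²`, `[x]₀^m / m`, `[y]₀^m / m` (`[·]₀^m` the clip to `[0, m]`), so the whole
chain holds with (i) weakened to continuous bounded test functions: `abs_cov_min_sub_cov_min_le_of_continuous`,
`abs_cov_sub_cov_le_of_continuous`, `covTransfer_torus_of_continuous`, `twoSidedLaw_of_referencePairs_of_continuous`,
`entropyBudgetTransfer_of_referencePairs_of_continuous` (statements otherwise verbatim).  Why it matters for KT2/KT3: the torus → box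
passage is linear in the test function — under the DLR disintegration `E_{β,L+1}[F] = ∫ (∫ F dγ_Λ(·|ext)) dμ(ext)` closeness of the
mixture is at most the average closeness of the conditional laws, no convexity needed — but the tree's DLR identity for torus states
(`wilsonExpectation_toTorusObservable_eq`, used in `ColdBoxAllGroups…DlrPlumbingG`) is stated for CONTINUOUS bounded cylinder
observables, and `h ∘ (β c₀, β c_n)` is one exactly when `h` is continuous.  Written by the width seat 2/3 of line `ym-line-ebe-p1` as
`--supports stmt-QuantumFields-22401`. [folklore]
-/

set_option autoImplicit false

noncomputable section

open MeasureTheory Set Filter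

namespace Summit.QuantumFields.YangMills.Theorems.EntropyBudgetEquipartition.CovTransfer

/-! ### Abstract part -/

section TwoMeasures

variable {E E' : Type*} [MeasurableSpace E] [MeasurableSpace E'] {P : Measure E} {Q : Measure E'}
  [IsProbabilityMeasure P] [IsProbabilityMeasure Q]

/-- **Closeness of the clipped covariances, CONTINUOUS test functions.** If the joint laws of `(X, Y)` under `P` and of `(X', Y')`
under `Q` are `δ`-close on CONTINUOUS test functions bounded by `1`, then for `m > 0` and non-negative
observables, `|Cov_P(X∧m, Y∧m) − Cov_Q(X'∧m, Y'∧m)| ≤ 3 m² δ`. [folklore] -/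
theorem abs_cov_min_sub_cov_min_le_of_continuous {X Y : E → ℝ} {X' Y' : E' → ℝ} (hX0 : ∀ e, 0 ≤ X e) (hY0 : ∀ e, 0 ≤ Y e)
    (hX'0 : ∀ e, 0 ≤ X' e) (hY'0 : ∀ e, 0 ≤ Y' e) {m δ : ℝ} (hm : 0 < m)
    (hclose : ∀ h : ℝ × ℝ → ℝ, Continuous h → (∀ z, |h z| ≤ 1) →
      |∫ e, h (X e, Y e) ∂P - ∫ e, h (X' e, Y' e) ∂Q| ≤ δ) :
    |(∫ e, min (X e) m * min (Y e) m ∂P - (∫ e, min (X e) m ∂P) * (∫ e, min (Y e) m ∂P)) -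
        (∫ e, min (X' e) m * min (Y' e) m ∂Q - (∫ e, min (X' e) m ∂Q) * (∫ e, min (Y' e) m ∂Q))| ≤
      3 * m ^ 2 * δ := by
  have hm0 : 0 ≤ m := hm.le
  have hm2 : 0 < m ^ 2 := by positivity
  -- the three test functions
  set c : ℝ → ℝ := fun x => max 0 (min x m) with hc
  have hcm : Continuous c := continuous_const.max (continuous_id.min continuous_const)
  have hcX : ∀ e, c (X e) = min (X e) m := fun e => max_eq_right (le_min (hX0 e) hm0)
  have hcY : ∀ e, c (Y e) = min (Y e) m := fun e => max_eq_right (le_min (hY0 e) hm0)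
  have hcX' : ∀ e, c (X' e) = min (X' e) m := fun e => max_eq_right (le_min (hX'0 e) hm0)
  have hcY' : ∀ e, c (Y' e) = min (Y' e) m := fun e => max_eq_right (le_min (hY'0 e) hm0)
  have habs : ∀ x, |c x| ≤ m := fun x => abs_max_min_le hm0
  -- product test function
  have h1 := hclose (fun z => c z.1 * c z.2 / m ^ 2)
    (((hcm.comp continuous_fst).mul (hcm.comp continuous_snd)).div_const _) (fun z => by
      rw [abs_div, abs_of_pos hm2, div_le_one hm2, abs_mul, sq]
      exact mul_le_mul (habs _) (habs _) (abs_nonneg _) hm0)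
  have h2 := hclose (fun z => c z.1 / m) ((hcm.comp continuous_fst).div_const _) (fun z => by
      rw [abs_div, abs_of_pos hm, div_le_one hm]; exact habs _)
  have h3 := hclose (fun z => c z.2 / m) ((hcm.comp continuous_snd).div_const _) (fun z => by
      rw [abs_div, abs_of_pos hm, div_le_one hm]; exact habs _)
  simp only [hcX, hcY, hcX', hcY'] at h1 h2 h3
  rw [integral_div, integral_div, ← sub_div, abs_div, abs_of_pos hm2, div_le_iff₀ hm2] at h1
  rw [integral_div, integral_div, ← sub_div, abs_div, abs_of_pos hm, div_le_iff₀ hm] at h2 h3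
  -- sizes of the clipped means
  have bP : |∫ e, min (Y e) m ∂P| ≤ m := by
    rw [abs_of_nonneg (integral_nonneg fun e => le_min (hY0 e) hm0)]
    calc ∫ e, min (Y e) m ∂P ≤ ∫ e, m ∂P := integral_mono_of_nonneg (ae_of_all _ fun e => le_min (hY0 e) hm0)
          (integrable_const m) (ae_of_all _ fun e => min_le_right _ _)
      _ = m := by simp
  have bQ : |∫ e, min (X' e) m ∂Q| ≤ m := by
    rw [abs_of_nonneg (integral_nonneg fun e => le_min (hX'0 e) hm0)]
    calc ∫ e, min (X' e) m ∂Q ≤ ∫ e, m ∂Q := integral_mono_of_nonneg (ae_of_all _ fun e => le_min (hX'0 e) hm0)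
          (integrable_const m) (ae_of_all _ fun e => min_le_right _ _)
      _ = m := by simp
  -- product of means
  have hprod : |(∫ e, min (X e) m ∂P) * (∫ e, min (Y e) m ∂P) - (∫ e, min (X' e) m ∂Q) * (∫ e, min (Y' e) m ∂Q)|
      ≤ 2 * m ^ 2 * δ := by
    have e1 : (∫ e, min (X e) m ∂P) * (∫ e, min (Y e) m ∂P) - (∫ e, min (X' e) m ∂Q) * (∫ e, min (Y' e) m ∂Q) =
        (∫ e, min (X e) m ∂P - ∫ e, min (X' e) m ∂Q) * (∫ e, min (Y e) m ∂P) +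
          (∫ e, min (X' e) m ∂Q) * (∫ e, min (Y e) m ∂P - ∫ e, min (Y' e) m ∂Q) := by ring
    rw [e1]
    refine (abs_add_le _ _).trans ?_
    rw [abs_mul, abs_mul]
    have t1 : |∫ e, min (X e) m ∂P - ∫ e, min (X' e) m ∂Q| * |∫ e, min (Y e) m ∂P| ≤ δ * m * m :=
      mul_le_mul h2 bP (abs_nonneg _) ((abs_nonneg _).trans h2)
    have t2 : |∫ e, min (X' e) m ∂Q| * |∫ e, min (Y e) m ∂P - ∫ e, min (Y' e) m ∂Q| ≤ m * (δ * m) :=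
      mul_le_mul bQ h3 (abs_nonneg _) ((abs_nonneg _).trans bQ)
    nlinarith
  have e2 : (∫ e, min (X e) m * min (Y e) m ∂P - (∫ e, min (X e) m ∂P) * (∫ e, min (Y e) m ∂P)) -
        (∫ e, min (X' e) m * min (Y' e) m ∂Q - (∫ e, min (X' e) m ∂Q) * (∫ e, min (Y' e) m ∂Q)) =
      (∫ e, min (X e) m * min (Y e) m ∂P - ∫ e, min (X' e) m * min (Y' e) m ∂Q) -
        ((∫ e, min (X e) m ∂P) * (∫ e, min (Y e) m ∂P) - (∫ e, min (X' e) m ∂Q) * (∫ e, min (Y' e) m ∂Q)) := by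
    ring
  rw [e2]
  exact (abs_sub _ _).trans (by nlinarith)

/-- **Covariance transfer, CONTINUOUS test functions** (as `abs_cov_sub_cov_le`, with the weaker closeness hypothesis). Two probability
spaces, non-negative observables bounded by `M` on each; if the joint laws of the pairs are `δ`-close on
continuous test functions bounded by `1`, then for every truncation level `m > 0`
`|Cov_P(X, Y) − Cov_Q(X', Y')| ≤ 3 m² δ + 2 M² (P{m < X} + P{m < Y} + Q{m < X'} + Q{m < Y'})`. [folklore] -/
theorem abs_cov_sub_cov_le_of_continuous {X Y : E → ℝ} {X' Y' : E' → ℝ} (hX : Measurable X) (hY : Measurable Y)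
    (hX' : Measurable X') (hY' : Measurable Y') {M : ℝ} (hM : 0 ≤ M)
    (hX0 : ∀ e, 0 ≤ X e) (hXM : ∀ e, X e ≤ M) (hY0 : ∀ e, 0 ≤ Y e) (hYM : ∀ e, Y e ≤ M)
    (hX'0 : ∀ e, 0 ≤ X' e) (hX'M : ∀ e, X' e ≤ M) (hY'0 : ∀ e, 0 ≤ Y' e) (hY'M : ∀ e, Y' e ≤ M)
    {m δ : ℝ} (hm : 0 < m)
    (hclose : ∀ h : ℝ × ℝ → ℝ, Continuous h → (∀ z, |h z| ≤ 1) →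
      |∫ e, h (X e, Y e) ∂P - ∫ e, h (X' e, Y' e) ∂Q| ≤ δ) :
    |(∫ e, X e * Y e ∂P - (∫ e, X e ∂P) * (∫ e, Y e ∂P)) -
        (∫ e, X' e * Y' e ∂Q - (∫ e, X' e ∂Q) * (∫ e, Y' e ∂Q))| ≤
      3 * m ^ 2 * δ + 2 * M ^ 2 * (P.real {e | m < X e} + P.real {e | m < Y e} +
        Q.real {e | m < X' e} + Q.real {e | m < Y' e}) := by
  have hP := abs_cov_sub_cov_min_le (P := P) hX hY hM hX0 hXM hY0 hYM hm.le
  have hQ := abs_cov_sub_cov_min_le (P := Q) hX' hY' hM hX'0 hX'M hY'0 hY'M hm.le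
  have hPQ := abs_cov_min_sub_cov_min_le_of_continuous (P := P) (Q := Q) hX0 hY0 hX'0 hY'0 hm hclose
  rw [abs_le] at hP hQ hPQ ⊢
  constructor <;> nlinarith [hP.1, hP.2, hQ.1, hQ.2, hPQ.1, hPQ.2]

end TwoMeasures

/-! ### Torus part -/

section Torus

open Literature.MathematicalPhysics.QuantumFieldTheory Literature.MathematicalPhysics.QuantumLattice
open Summit.QuantumFields.YangMills.Theorems.WeakCouplingRates
open Summit.QuantumFields.YangMills.Theorems.ColdBoxAllGroups (measureReal_plaqCost_ge_le_allSidesG)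

variable {G : Type} [Group G] [TopologicalSpace G] [IsTopologicalGroup G] [CompactSpace G]
  [MeasurableSpace G] [BorelSpace G]

/-- **Covariance transfer for the torus Wilson state, CONTINUOUS test functions** (as `covTransfer_torus`, whose closeness
hypothesis quantified over measurable test functions; continuity is what the tree's DLR identities
`wilsonExpectation_toTorusObservable_eq` require of an observable).
For a lattice representation `r` of a compact group `G` there are `C > 0`, `κ ∈ ℕ` such that: for every torus
`Λ_{L+1}` (`L ≥ 1`), `β ≥ 1`, separation `n`, every probability space `(E', Q)` with a pair `0 ≤ X', Y' ≤ 2Nβ`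
whose joint law is `δ`-close on continuous test functions bounded by `1` to the joint law of
`(β c₀, β c_n)` under `μ_{β, L+1}` (`c₀`, `c_n` the `(1,2)` plaquette costs at the origin and at `n e₀`, read
through the periodic lift as in item 22401), and every truncation level `m > 0`,
`|β² Cov_{β,L+1}(c₀, c_n) − Cov_Q(X', Y')| ≤ 3 m² δ + C β^{κ+2} e^{−m/2} + 8 (Nβ)² (Q{m < X'} + Q{m < Y'})`.
The `μ`-side truncation is paid by the tree's all-`G` single-plaquette tail
`ColdBoxAllGroups.measureReal_plaqCost_ge_le_allSidesG` (Fröhlich–Israel–Lieb–Simon chessboard).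
[cite: FrohlichIsraelLiebSimon1978, Thm. 4.1] -/
theorem covTransfer_torus_of_continuous (r : LatticeRep G) :
    ∃ C : ℝ, 0 < C ∧ ∃ κ : ℕ, ∀ (L : ℕ), 1 ≤ L → ∀ (β : ℝ), 1 ≤ β → ∀ (n : ℕ)
      {E' : Type*} [MeasurableSpace E'] (Q : Measure E') [IsProbabilityMeasure Q] (X' Y' : E' → ℝ),
      Measurable X' → Measurable Y' → (∀ e, 0 ≤ X' e) → (∀ e, X' e ≤ 2 * r.N * β) →
      (∀ e, 0 ≤ Y' e) → (∀ e, Y' e ≤ 2 * r.N * β) →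
      ∀ (m δ : ℝ), 0 < m →
      (∀ h : ℝ × ℝ → ℝ, Continuous h → (∀ z, |h z| ≤ 1) →
        |wilsonExpectation (L := L + 1) r.ρ β (toTorusObservable (L + 1) fun U =>
            h (β * plaqCost0 (d := 4) r.ρ 1 2 U, β * plaqCost0 (d := 4) r.ρ 1 2 (timeShiftLG (G := G) n U))) -
          ∫ e, h (X' e, Y' e) ∂Q| ≤ δ) →
      |β ^ 2 * (wilsonExpectation (L := L + 1) r.ρ β (toTorusObservable (L + 1) fun U =>
              plaqCost0 (d := 4) r.ρ 1 2 U * plaqCost0 (d := 4) r.ρ 1 2 (timeShiftLG (G := G) n U)) -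
            wilsonExpectation (L := L + 1) r.ρ β (toTorusObservable (L + 1) (plaqCost0 (d := 4) r.ρ 1 2)) *
              wilsonExpectation (L := L + 1) r.ρ β (toTorusObservable (L + 1) fun U =>
                plaqCost0 (d := 4) r.ρ 1 2 (timeShiftLG (G := G) n U))) -
          (∫ e, X' e * Y' e ∂Q - (∫ e, X' e ∂Q) * (∫ e, Y' e ∂Q))| ≤
        3 * m ^ 2 * δ + C * β ^ (κ + 2) * Real.exp (-(m / 2)) +
          8 * ((r.N : ℝ) * β) ^ 2 * (Q.real {e | m < X' e} + Q.real {e | m < Y' e}) := by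
  haveI : SecondCountableTopology G := r.secondCountableTopology
  obtain ⟨C, hC, κ, htail⟩ := measureReal_plaqCost_ge_le_allSidesG r
  refine ⟨16 * (r.N : ℝ) ^ 2 * C + 1, by positivity, κ, ?_⟩
  intro L hL β hβ n E' _ Q _ X' Y' hX'm hY'm hX'0 hX'M hY'0 hY'M m δ hm hclose
  have hβ0 : 0 < β := lt_of_lt_of_le one_pos hβ
  set ρ := r.ρ with hρdef
  set P : Measure (GaugeConfig 4 (L + 1) G) := wilsonMeasure (d := 4) (L := L + 1) ρ β with hP
  haveI : IsProbabilityMeasure P := isProbabilityMeasure_wilsonMeasure (d := 4) (L := L + 1) ρ r.continuous β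
  -- the two observables on the torus
  set X : GaugeConfig 4 (L + 1) G → ℝ := fun U => β * plaqCost0 (d := 4) ρ 1 2 (torusLift (L + 1) U) with hXd
  set Y : GaugeConfig 4 (L + 1) G → ℝ :=
    fun U => β * plaqCost0 (d := 4) ρ 1 2 (timeShiftLG (G := G) n (torusLift (L + 1) U)) with hYd
  have hc : Continuous (plaqCost0 (d := 4) (G := G) ρ 1 2) := (continuous_bounded_plaqCost0 ρ r.continuous 1 2).1
  have hXm : Measurable X :=
    (continuous_const.mul (hc.comp (continuous_torusLift (L + 1)))).measurable
  have hYm : Measurable Y :=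
    (continuous_const.mul (hc.comp ((continuous_timeShiftLG n).comp (continuous_torusLift (L + 1))))).measurable
  have hM : (0 : ℝ) ≤ 2 * r.N * β := by positivity
  have hXb : ∀ U, 0 ≤ X U ∧ X U ≤ 2 * r.N * β := fun U => by
    obtain ⟨h0, h2⟩ := plaqCost0_mem ρ r.mem_unitary 1 2 (torusLift (L + 1) U)
    exact ⟨mul_nonneg hβ0.le h0, by rw [hXd]; nlinarith⟩
  have hYb : ∀ U, 0 ≤ Y U ∧ Y U ≤ 2 * r.N * β := fun U => by
    obtain ⟨h0, h2⟩ := plaqCost0_mem ρ r.mem_unitary 1 2 (timeShiftLG (G := G) n (torusLift (L + 1) U))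
    exact ⟨mul_nonneg hβ0.le h0, by rw [hYd]; nlinarith⟩
  -- closeness, in integral form
  have hclose' : ∀ h : ℝ × ℝ → ℝ, Continuous h → (∀ z, |h z| ≤ 1) →
      |∫ U, h (X U, Y U) ∂P - ∫ e, h (X' e, Y' e) ∂Q| ≤ δ := by
    intro h hh hb
    have := hclose h hh hb
    simpa only [wilsonExpectation, toTorusObservable_apply] using this
  -- the abstract transfer
  have habs := abs_cov_sub_cov_le_of_continuous (P := P) (Q := Q) hXm hYm hX'm hY'm hM (fun U => (hXb U).1)
    (fun U => (hXb U).2) (fun U => (hYb U).1) (fun U => (hYb U).2) hX'0 hX'M hY'0 hY'M hm hclose'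
  -- the μ-side tails
  have hL2 : 2 ≤ L + 1 := by omega
  have hs : 0 ≤ m / β := div_nonneg hm.le hβ0.le
  have h12 : (1 : Fin 4) ≠ 2 := by decide
  have tX : P.real {U | m < X U} ≤ C * β ^ κ * Real.exp (-(m / 2)) := by
    have hsub : {U | m < X U} ⊆ {U : GaugeConfig 4 (L + 1) G |
        m / β ≤ (r.N : ℝ) - (r.ρ (plaquetteHolonomy U 0 1 2)).trace.re} := by
      intro U hU
      simp only [Set.mem_setOf_eq] at hU ⊢
      rw [hXd] at hU
      simp only [plaqCost0_torusLift] at hU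
      rw [div_le_iff₀ hβ0]
      linarith
    have h1 := htail (L := L + 1) hL2 β hβ (m / β) hs (0 : Site 4 (L + 1)) h12
    have e1 : β * (m / β) / 2 = m / 2 := by field_simp
    rw [e1] at h1
    exact (measureReal_mono hsub).trans h1
  have tY : P.real {U | m < Y U} ≤ C * β ^ κ * Real.exp (-(m / 2)) := by
    have hsub : {U | m < Y U} ⊆ {U : GaugeConfig 4 (L + 1) G |
        m / β ≤ (r.N : ℝ) - (r.ρ (plaquetteHolonomy U
          (Literature.Probability.LatticeModels.Torus.proj (L + 1) (Pi.single 0 (n : ℤ))) 1 2)).trace.re} := by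
      intro U hU
      simp only [Set.mem_setOf_eq] at hU ⊢
      rw [hYd] at hU
      simp only [plaqCost0_timeShiftLG_torusLift] at hU
      rw [div_le_iff₀ hβ0]
      linarith
    have h1 := htail (L := L + 1) hL2 β hβ (m / β) hs
      (Literature.Probability.LatticeModels.Torus.proj (L + 1) (Pi.single 0 (n : ℤ))) h12
    have e1 : β * (m / β) / 2 = m / 2 := by field_simp
    rw [e1] at h1
    exact (measureReal_mono hsub).trans h1
  -- rewrite the goal in terms of `X`, `Y`
  have iXY : ∫ U, X U * Y U ∂P = β ^ 2 * wilsonExpectation (L := L + 1) ρ β (toTorusObservable (L + 1) fun U =>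
      plaqCost0 (d := 4) ρ 1 2 U * plaqCost0 (d := 4) ρ 1 2 (timeShiftLG (G := G) n U)) := by
    simp only [wilsonExpectation, toTorusObservable_apply, hXd, hYd, hP, ← integral_const_mul]
    congr 1; funext U; ring
  have iX : ∫ U, X U ∂P = β * wilsonExpectation (L := L + 1) ρ β (toTorusObservable (L + 1) (plaqCost0 (d := 4) ρ 1 2)) := by
    simp only [wilsonExpectation, toTorusObservable_apply, hXd, hP, ← integral_const_mul]
  have iY : ∫ U, Y U ∂P = β * wilsonExpectation (L := L + 1) ρ β (toTorusObservable (L + 1) fun U =>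
      plaqCost0 (d := 4) ρ 1 2 (timeShiftLG (G := G) n U)) := by
    simp only [wilsonExpectation, toTorusObservable_apply, hYd, hP, ← integral_const_mul]
  rw [iXY, iX, iY] at habs
  have e3 : β ^ 2 * (wilsonExpectation (L := L + 1) ρ β (toTorusObservable (L + 1) fun U =>
              plaqCost0 (d := 4) ρ 1 2 U * plaqCost0 (d := 4) ρ 1 2 (timeShiftLG (G := G) n U)) -
            wilsonExpectation (L := L + 1) ρ β (toTorusObservable (L + 1) (plaqCost0 (d := 4) ρ 1 2)) *
              wilsonExpectation (L := L + 1) ρ β (toTorusObservable (L + 1) fun U =>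
                plaqCost0 (d := 4) ρ 1 2 (timeShiftLG (G := G) n U))) =
      β ^ 2 * wilsonExpectation (L := L + 1) ρ β (toTorusObservable (L + 1) fun U =>
              plaqCost0 (d := 4) ρ 1 2 U * plaqCost0 (d := 4) ρ 1 2 (timeShiftLG (G := G) n U)) -
        β * wilsonExpectation (L := L + 1) ρ β (toTorusObservable (L + 1) (plaqCost0 (d := 4) ρ 1 2)) *
          (β * wilsonExpectation (L := L + 1) ρ β (toTorusObservable (L + 1) fun U =>
            plaqCost0 (d := 4) ρ 1 2 (timeShiftLG (G := G) n U))) := by ring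
  rw [e3]
  refine habs.trans ?_
  -- arithmetic of the error terms
  have hpX : 0 ≤ Q.real {e | m < X' e} := measureReal_nonneg
  have hpY : 0 ≤ Q.real {e | m < Y' e} := measureReal_nonneg
  have hexp : 0 ≤ Real.exp (-(m / 2)) := (Real.exp_pos _).le
  have hβκ : 0 ≤ β ^ κ := pow_nonneg hβ0.le κ
  have hsum : P.real {U | m < X U} + P.real {U | m < Y U} ≤ 2 * (C * β ^ κ * Real.exp (-(m / 2))) := by linarith
  have hstep : 2 * (2 * r.N * β) ^ 2 * (P.real {U | m < X U} + P.real {U | m < Y U} +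
        Q.real {e | m < X' e} + Q.real {e | m < Y' e}) ≤
      (16 * (r.N : ℝ) ^ 2 * C + 1) * β ^ (κ + 2) * Real.exp (-(m / 2)) +
        8 * ((r.N : ℝ) * β) ^ 2 * (Q.real {e | m < X' e} + Q.real {e | m < Y' e}) := by
    have e4 : 2 * (2 * r.N * β) ^ 2 * (P.real {U | m < X U} + P.real {U | m < Y U} +
          Q.real {e | m < X' e} + Q.real {e | m < Y' e}) =
        8 * ((r.N : ℝ) * β) ^ 2 * (P.real {U | m < X U} + P.real {U | m < Y U}) +
          8 * ((r.N : ℝ) * β) ^ 2 * (Q.real {e | m < X' e} + Q.real {e | m < Y' e}) := by ring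
    rw [e4]
    have e5 : 8 * ((r.N : ℝ) * β) ^ 2 * (2 * (C * β ^ κ * Real.exp (-(m / 2)))) =
        16 * (r.N : ℝ) ^ 2 * C * β ^ (κ + 2) * Real.exp (-(m / 2)) := by ring
    have h8 : 0 ≤ 8 * ((r.N : ℝ) * β) ^ 2 := by positivity
    have h9 := mul_le_mul_of_nonneg_left hsum h8
    rw [e5] at h9
    have h10 : 0 ≤ β ^ (κ + 2) * Real.exp (-(m / 2)) := by positivity
    nlinarith
  linarith

/-- **The two-sided free-gluon law at `(G, r)` from reference pair laws, CONTINUOUS test functions** (as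
`twoSidedLaw_of_referencePairs` with hypothesis (i) weakened to continuous test functions of the pair bounded by `1`); the conclusion is the conclusion of
`EntropyBudgetTransfer` at `(G, r)`, with exponent `min(κ₁/2, 1)` and the hypothesis' own `A`, `σ`.
[cite: BoucheronLugosiMassart2013, §4.11 Thm. 4.19] -/
theorem twoSidedLaw_of_referencePairs_of_continuous (r : LatticeRep G)
    (href : ∃ κ₁ A σ C₁ β₀ : ℝ, 0 < κ₁ ∧ 0 < A ∧ 0 < σ ∧ ∀ β : ℝ, β₀ ≤ β → ∀ n : ℕ, 1 ≤ n → (n : ℝ) ≤ 2 * β ^ A →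
      ∀ᶠ L : ℕ in atTop, ∃ (E' : Type) (_ : MeasurableSpace E') (Q : Measure E') (_ : IsProbabilityMeasure Q)
        (X' Y' : E' → ℝ), Measurable X' ∧ Measurable Y' ∧ (∀ e, 0 ≤ X' e ∧ X' e ≤ 2 * r.N * β) ∧
        (∀ e, 0 ≤ Y' e ∧ Y' e ≤ 2 * r.N * β) ∧
        (∀ h : ℝ × ℝ → ℝ, Continuous h → (∀ z, |h z| ≤ 1) →
          |wilsonExpectation (L := L + 1) r.ρ β (toTorusObservable (L + 1) fun U =>
              h (β * plaqCost0 (d := 4) r.ρ 1 2 U, β * plaqCost0 (d := 4) r.ρ 1 2 (timeShiftLG (G := G) n U))) -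
            ∫ e, h (X' e, Y' e) ∂Q| ≤ β ^ (-κ₁)) ∧
        |(∫ e, X' e * Y' e ∂Q - (∫ e, X' e ∂Q) * (∫ e, Y' e ∂Q)) -
            σ * (curvaturePlaquetteCorr (d := 4) (by norm_num) (n : ℤ)) ^ 2| ≤ C₁ * β ^ (-κ₁) ∧
        Q.real {e | Real.log β ^ 2 + 1 < X' e} + Q.real {e | Real.log β ^ 2 + 1 < Y' e} ≤ β ^ (-(3 : ℝ))) :
    ∃ κ A C σ β₀ : ℝ, 0 < κ ∧ 0 < A ∧ 0 < σ ∧ ∀ β : ℝ, β₀ ≤ β → ∀ n : ℕ, 1 ≤ n → (n : ℝ) ≤ 2 * β ^ A →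
      ∀ᶠ L : ℕ in atTop, |β ^ 2 * (wilsonExpectation (L := L + 1) r.ρ β (toTorusObservable (L + 1) fun U =>
          plaqCost0 (d := 4) r.ρ 1 2 U * plaqCost0 (d := 4) r.ρ 1 2 (timeShiftLG (G := G) n U)) -
        wilsonExpectation (L := L + 1) r.ρ β (toTorusObservable (L + 1) (plaqCost0 (d := 4) r.ρ 1 2)) *
          wilsonExpectation (L := L + 1) r.ρ β (toTorusObservable (L + 1) fun U =>
            plaqCost0 (d := 4) r.ρ 1 2 (timeShiftLG (G := G) n U))) -
        σ * (curvaturePlaquetteCorr (d := 4) (by norm_num) (n : ℤ)) ^ 2| ≤ C * β ^ (-κ) := by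
  obtain ⟨κ₁, A, σ, C₁, β₀, hκ₁, hA, hσ, H⟩ := href
  obtain ⟨C, hC, κ, T⟩ := covTransfer_torus_of_continuous r
  -- constants
  set K : ℝ := ((8 / κ₁) ^ 2 + 1) ^ 2 with hK
  have hK0 : 0 ≤ K := by positivity
  refine ⟨min (κ₁ / 2) 1, A, 3 * K + |C₁| + C + 8 * (r.N : ℝ) ^ 2, σ,
    max β₀ (max 1 (Real.exp (2 * ((κ : ℝ) + 3)))), by positivity, hA, hσ, ?_⟩
  intro β hβ n hn1 hnA
  have hβ₀ : β₀ ≤ β := (le_max_left _ _).trans hβ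
  have hβ1 : 1 ≤ β := (le_max_left _ _).trans ((le_max_right _ _).trans hβ)
  have hβe : Real.exp (2 * ((κ : ℝ) + 3)) ≤ β := (le_max_right _ _).trans ((le_max_right _ _).trans hβ)
  have hβ0 : 0 < β := lt_of_lt_of_le one_pos hβ1
  have hlog : 2 * ((κ : ℝ) + 3) ≤ Real.log β := by
    rw [← Real.log_exp (2 * ((κ : ℝ) + 3))]; exact Real.log_le_log (Real.exp_pos _) hβe
  filter_upwards [H β hβ₀ n hn1 hnA, eventually_ge_atTop 1] with L hL hL1
  obtain ⟨E', mE', Q, hQ, X', Y', hX'm, hY'm, hX'b, hY'b, hclose, hcov, htails⟩ := hL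
  set m : ℝ := Real.log β ^ 2 + 1 with hm
  have hm0 : 0 < m := by positivity
  have hT := T L hL1 β hβ1 n Q X' Y' hX'm hY'm (fun e => (hX'b e).1) (fun e => (hX'b e).2)
    (fun e => (hY'b e).1) (fun e => (hY'b e).2) m (β ^ (-κ₁)) hm0 hclose
  -- the four error terms
  have t1 : 3 * m ^ 2 * β ^ (-κ₁) ≤ 3 * K * β ^ (-(κ₁ / 2)) := by
    have h1 : m ^ 2 ≤ K * β ^ (κ₁ / 2) := logSq_add_one_sq_le hβ1 hκ₁
    have h2 : β ^ (κ₁ / 2) * β ^ (-κ₁) = β ^ (-(κ₁ / 2)) := by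
      rw [← Real.rpow_add hβ0]; congr 1; ring
    have h3 : 0 ≤ β ^ (-κ₁) := (Real.rpow_pos_of_pos hβ0 _).le
    calc 3 * m ^ 2 * β ^ (-κ₁) ≤ 3 * (K * β ^ (κ₁ / 2)) * β ^ (-κ₁) := by gcongr
      _ = 3 * K * β ^ (-(κ₁ / 2)) := by rw [← h2]; ring
  have t2 : C * β ^ (κ + 2) * Real.exp (-(m / 2)) ≤ C * β ^ (-(1 : ℝ)) := by
    have := pow_mul_exp_neg_logSq_le (κ := κ) hβ1 hlog
    rw [hm, mul_assoc]
    exact mul_le_mul_of_nonneg_left this hC.le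
  have t3 : 8 * ((r.N : ℝ) * β) ^ 2 * (Q.real {e | m < X' e} + Q.real {e | m < Y' e}) ≤
      8 * (r.N : ℝ) ^ 2 * β ^ (-(1 : ℝ)) := by
    have h1 : 8 * ((r.N : ℝ) * β) ^ 2 * (Q.real {e | m < X' e} + Q.real {e | m < Y' e}) ≤
        8 * ((r.N : ℝ) * β) ^ 2 * β ^ (-(3 : ℝ)) := mul_le_mul_of_nonneg_left htails (by positivity)
    have h2 : ((r.N : ℝ) * β) ^ 2 * β ^ (-(3 : ℝ)) = (r.N : ℝ) ^ 2 * β ^ (-(1 : ℝ)) := by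
      rw [mul_pow, mul_assoc]
      congr 1
      rw [← Real.rpow_natCast, ← Real.rpow_add hβ0]; norm_num
    calc _ ≤ 8 * ((r.N : ℝ) * β) ^ 2 * β ^ (-(3 : ℝ)) := h1
      _ = 8 * (r.N : ℝ) ^ 2 * β ^ (-(1 : ℝ)) := by rw [mul_assoc, h2, ← mul_assoc]
  have t4 : C₁ * β ^ (-κ₁) ≤ |C₁| * β ^ (-(κ₁ / 2)) :=
    mul_le_mul (le_abs_self C₁) (Real.rpow_le_rpow_of_exponent_le hβ1 (by linarith))
      (Real.rpow_pos_of_pos hβ0 _).le (abs_nonneg _)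
  -- monotonicity in the exponent: `β^{-a} ≤ β^{-min(κ₁/2,1)}` for `a ∈ {κ₁/2, 1}`
  have p1 : β ^ (-(κ₁ / 2)) ≤ β ^ (-min (κ₁ / 2) 1) :=
    Real.rpow_le_rpow_of_exponent_le hβ1 (by simp)
  have p2 : β ^ (-(1 : ℝ)) ≤ β ^ (-min (κ₁ / 2) 1) :=
    Real.rpow_le_rpow_of_exponent_le hβ1 (by simp)
  -- combine: `|a − c| ≤ |a − b| + |b − c|`
  have step := abs_sub_le
    (β ^ 2 * (wilsonExpectation (L := L + 1) r.ρ β (toTorusObservable (L + 1) fun U =>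
          plaqCost0 (d := 4) r.ρ 1 2 U * plaqCost0 (d := 4) r.ρ 1 2 (timeShiftLG (G := G) n U)) -
        wilsonExpectation (L := L + 1) r.ρ β (toTorusObservable (L + 1) (plaqCost0 (d := 4) r.ρ 1 2)) *
          wilsonExpectation (L := L + 1) r.ρ β (toTorusObservable (L + 1) fun U =>
            plaqCost0 (d := 4) r.ρ 1 2 (timeShiftLG (G := G) n U))))
    (∫ e, X' e * Y' e ∂Q - (∫ e, X' e ∂Q) * (∫ e, Y' e ∂Q))
    (σ * (curvaturePlaquetteCorr (d := 4) (by norm_num) (n : ℤ)) ^ 2)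
  have hKβ : 0 ≤ 3 * K := by positivity
  have hN : 0 ≤ 8 * (r.N : ℝ) ^ 2 := by positivity
  nlinarith [mul_le_mul_of_nonneg_left p1 hKβ, mul_le_mul_of_nonneg_left p1 (abs_nonneg C₁),
    mul_le_mul_of_nonneg_left p2 hC.le, mul_le_mul_of_nonneg_left p2 hN, hT, hcov, step, t1, t2, t3, t4]

/-- **The crux `EntropyBudgetTransfer` from reference pair laws at every `(G, r)`, CONTINUOUS test functions.**
A reduction of a RECORD-label rung crux to the genuine output of KT2 + KT3; NOT the Clay mass gap.
[cite: BoucheronLugosiMassart2013, §4.11 Thm. 4.19] -/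
theorem entropyBudgetTransfer_of_referencePairs_of_continuous
    (href : ∀ (G : Type) [Group G] [TopologicalSpace G] [IsTopologicalGroup G] [CompactSpace G], IsCompactSimpleLieGroup G →
      letI : MeasurableSpace G := borel G; haveI : BorelSpace G := ⟨rfl⟩; ∀ r : LatticeRep G,
      ∃ κ₁ A σ C₁ β₀ : ℝ, 0 < κ₁ ∧ 0 < A ∧ 0 < σ ∧ ∀ β : ℝ, β₀ ≤ β → ∀ n : ℕ, 1 ≤ n → (n : ℝ) ≤ 2 * β ^ A →
      ∀ᶠ L : ℕ in atTop, ∃ (E' : Type) (_ : MeasurableSpace E') (Q : Measure E') (_ : IsProbabilityMeasure Q)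
        (X' Y' : E' → ℝ), Measurable X' ∧ Measurable Y' ∧ (∀ e, 0 ≤ X' e ∧ X' e ≤ 2 * r.N * β) ∧
        (∀ e, 0 ≤ Y' e ∧ Y' e ≤ 2 * r.N * β) ∧
        (∀ h : ℝ × ℝ → ℝ, Continuous h → (∀ z, |h z| ≤ 1) →
          |wilsonExpectation (L := L + 1) r.ρ β (toTorusObservable (L + 1) fun U =>
              h (β * plaqCost0 (d := 4) r.ρ 1 2 U, β * plaqCost0 (d := 4) r.ρ 1 2 (timeShiftLG (G := G) n U))) -
            ∫ e, h (X' e, Y' e) ∂Q| ≤ β ^ (-κ₁)) ∧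
        |(∫ e, X' e * Y' e ∂Q - (∫ e, X' e ∂Q) * (∫ e, Y' e ∂Q)) -
            σ * (curvaturePlaquetteCorr (d := 4) (by norm_num) (n : ℤ)) ^ 2| ≤ C₁ * β ^ (-κ₁) ∧
        Q.real {e | Real.log β ^ 2 + 1 < X' e} + Q.real {e | Real.log β ^ 2 + 1 < Y' e} ≤ β ^ (-(3 : ℝ))) :
    Summit.QuantumFields.YangMills.Theses.EntropyBudgetEquipartition.EntropyBudgetTransfer := by
  intro G _ _ _ _ hG
  letI : MeasurableSpace G := borel G
  haveI : BorelSpace G := ⟨rfl⟩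
  intro r _
  exact twoSidedLaw_of_referencePairs_of_continuous r (href G hG r)

end Torus

end Summit.QuantumFields.YangMills.Theorems.EntropyBudgetEquipartition.CovTransfer

end
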